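import Literature.MathematicalPhysics.QuantumFieldTheory.Balaban1983to89.Node00.Record12BgRowCoClass

/-!
# NODE 00 — ROW P11 UNDER F7 (director-ym №160): print's TOP DOMAIN `Ω₀` of the variational problem — the scale-0 ranges of MY three level-0 tokens
# ((1.9)₀ `Sect2.omegaBonds … 0 = univ`, (7)₀ `Sect2.printedPlaqs … k 0`, and the scale-0 class bound read by the row's analysis) RE-RANGED TO A SUPPORT `Ω₀ ⊆ T_η`,
# GENERIC in `Ω₀` (node00-def-R ∕ def-T instantiate the support of record)

Cell `pub-ymgap`, seat `pub-ymgap-node00-def-P11` g3 (R218).  director-ym №154 FINDING №7 ∕ №160 RULING (F7 adopted: (F7-a) def-T 12a″, (F7-b) def-R FILE 22′ «class (1.7) scale-0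
clause re-ranged to the collar», (F7-c) RECORD 13 v1.5 `CoP`; EDITION FREEZE); this seat's LOCATED-P11-LEVEL0-RANGES (INBOX l.18283): print [15] p.278 — «The space U_k({Ω_j}, ε₀) of gauge field
configurations ON Ω₀ … (2) for p ∈ Ω_j, b ∈ Ω_j, j = 0, 1, …, k», the action (5) «Σ_{p ⊂ Ω₀}», the data (3) on `Λ_j ⊂ Ω₀`; [III] p.255 takes `Ω₀` = the SUPPORT («the domain Ω₁, or rather
a small neighborhood of Ω₁ including a layer of M₁-cubes»).  The tree hard-wires `Ω₀ = T_η` at three level-0 places (r11's `Seq.Ω_off` forces `s.Ω 0 = ∅`, so every scale-0 reading was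
typed as «the whole torus»): (B1) def-R's (1.7)₀ `omegaPlaqs s.Ω 0 = univ` — re-ranged by def-R's FILE 22′; (B2) MY (1.9)₀ `Sect2.omegaBonds s.Ω 0 = univ` (FILE 9) inside
`Sect2.CoDivClassOn`, READ by FILE 22's `regMSCoOfRecord`; (B3) MY (7)₀ `Sect2.printedPlaqs s.Ω k 0` (FILE 8, every fine plaquette touching `Ω₁ᶜ` with no bond inside `Ω₁`) inside the
support guard `h7 = Sect2.DataSmall7P`.  Left at `univ`, (B2)∕(B3) re-create FINDING №7 one row down: rough large-field data far from `Ω₁` violate global (1.9)₀ ∕ (7)₀, the class ∕ support is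
empty there, and the background ∕ row `bg` is junk ∕ vacuous exactly at the data the K1 junction evaluates.

THIS FILE types the `Ω₀`-generic twins of (B2) and (B3) and the scale-0-free form of FILE 10 §2's analysis — NO dependence on def-R's FILE 22′ (the support of record `Ω₀(s)` is ONE set
token, def-R's ∕ def-T's, read by name downstream):
* §1 `Sect2.omegaPlaqsTop Ω Ω₀ j := plaqsOf (if j = 0 then Ω₀ else Ω j)` and `Sect2.omegaBondsTop Ω Ω₀ j := bondsOf (if j = 0 then Ω₀ else Ω j)` — the (1.7)∕(1.9) plaquette∕bond
  sets with scale 0 read on `Ω₀` («p, b ∈ Ω₀», p.77 «meeting» convention, the one FILE 16∕FILE 9 use at `j ≥ 1`) instead of `T_η`; `= omegaPlaqs Ω j` ∕ `= Sect2.omegaBonds Ω j` at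
  `Ω₀ = univ`.  node00-def-R's FILE 22′ (SCOPE WORD INBOX l.18343) writes the same sets as `plaqsOf (seqTop Ω₀ Ω j)` ∕ `bondsOf (seqTop Ω₀ Ω j)` with `seqTop Ω₀ Ω j := if j = 0 then Ω₀
  else Ω j` — the `if` sits INSIDE `plaqsOf`∕`bondsOf` here too, so the two spellings agree by `rfl` once both files are in the tree (no import either way).
* §2 ★ `Sect2.CoDivClassOnTop Ω Ω₀ k ε U` — the (1.9)-half of `U_k({Ω_j}, ε)` ON `Ω₀`: `∀ j ≤ k`, co-divergence `< ε·η_j³` on `omegaBondsTop Ω Ω₀ j`; `CoDivClassOn.toTop`, `coDivClassOnTop_univ_iff`,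
  antitone in `Ω₀`.
* §3 ★ `Sect2.printedPlaqsTop Ω Ω₀ k := printedPlaqs Ω k 0 ∩ plaqsOf Ω₀` — print's (7) plaquettes AT LEVEL 0 for the top domain `Ω₀`: FILE 8's CONCORD range (touching `Ω₁ᶜ`, no bond
  inside `Ω₁`) cut to the plaquettes MEETING `Ω₀`.  WHY «meeting» and not «inside»: the class (1.7)₀ and the conclusion (8)₀ range over `plaqsOf Ω₀` (def-R's D3, p.77 convention), which on the
  torus contains plaquettes meeting `Ω₀` at its outer rim with all four bonds PINNED data; every all-pinned plaquette in (8)₀'s range must be a (7)₀ plaquette, or the fact demands `B₃δ₀`-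
  smallness of data that (7) never constrained (a free refutation at the rim) — with this cut it is (an all-pinned plaquette has no bond inside `Ω₁`, hence is printed), and so is the whole stencil
  of (8)₀'s co-divergence member at a pinned bond meeting `Ω₀` (its `2(d−1)` plaquettes all contain the bond's endpoint in `Ω₀`).  In print the configurations live on `Ω₀`, so rim plaquettes
  sticking out do not exist and both readings collapse; in the application the data one step beyond the support are small-field anyway ((1.10): margin `2LMR₁`).  ★ `Sect2.DataSmall7PTop av Ω Ω₀ k δ W`
  — (7) with that level-0 range, levels `≥ 1` VERBATIM `DataSmall7P`'s clause; `DataSmall7P.toTop`, `.of_le`, `.succ`, `.of_spliceAt`, `dataSmall7PTop_univ_iff`, antitone in `Ω₀`.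
* §4 ★★ `bgRowAtDatumU_of_classBoundsC1Pos` — FILE 10 §2's ★★ `bgRowAtDatumU_of_classBoundsC1` with the SCALE-0 class bound DROPPED from the hypotheses (`hclass : ∀ n, 1 ≤ n → n ≤ k → …`):
  the row's body (`U^c_j ∕ Ũ^c_j` membership for `X ⊂ Λ_j(s)`, `1 ≤ j ≤ k`) never reads the scale-0 bound (FILE 10 :168–170, :197–201 use it at `1 ≤ n` only), so a conclusion (8) whose
  scale-0 member lives on `Ω₀ ≠ T_η` feeds the row unchanged.  Proof = FILE 10's, verbatim.
The top-domain [15] fact (`VariationalThm1RegSepTop7 F N Sup B₃ a₀ a₁`, generic in a support selector `Sup`; class literal = def-R's FILE 22′ `regMSCoPOfRecordAt` up to `rfl`, data `DataSmall7PTop`,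
conclusion (8) with scale 0 on `Ω₀ = Sup ν K s.Ω`) and its generic suppliers follow in `Node00/Record12BgRowTopClass.lean` (INTENT-12b); the instantiation at def-R's `UbgMSCoPOfRecord`
(`Sup := suppDomOfRecord`) in `Node00/Record12BgRowCoClassCP.lean` on FILE 22′ (INTENT-12c).

HONEST FRAMING.  Set bookkeeping + FILE 10's elementary analysis re-run; five `def`s (three plaquette∕bond sets, two predicates), no named fact, no `instance`, no `sorry`; nothing of
Bałaban asserted or discharged; K0⁗ NOT closed; counts unmoved (typed 28∕28 · discharged 5∕28); one finite `𝕋⁴` torus family at fixed `ε = L^{−K}`; not continuum ∕ OS ∕ mass gap ∕ Clay.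

DEPENDENCES (by name): FILE 8 `Node00.Record12BgRowMixed` (`Sect2.printedPlaqs`, `Sect2.mixedField`, `Sect2.DataSmall7P`), FILE 16 `omegaPlaqs(_of_ne_zero)` (def-R), FILE 9 `Node00.Record12BgRowCoDiv`
(`Sect2.CoDivSmallOn`, `Sect2.omegaBonds`, `Sect2.CoDivClassOn`), FILE 10 `Node00.Record12BgRowCoClass` (`ofBackgroundC_mem_spaceI∕MS_of_classBoundU` and §2's proof), FILE 3∕4∕7b
(`hcubeΩ_of_compatible`, `localGauge_cubesI_of_classBound`, `condII238_cubesMS_of_classBounds`, `h3I_of_plaqC1`, `h3MS_of_plaqC1`, `hsmall_side_of_LM∕_M`, `side_pred_mul_eta_le[']`,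
`L_pow_mul_eta`), r12 `B15DeterminingSets.(bondsOf, genSet, spliceAt)`, `B8Eq17ClassAkV1.(plaqsOf, plaqsOf_mono, plaqsOf_univ, bondsOf_univ)`.
-/

noncomputable section

open MeasureTheory
open scoped Matrix.Norms.L2Operator

namespace Literature.MathematicalPhysics.QuantumFieldTheory.Balaban1983to89.Node00

open T4Continuum B14.Eq218Concrete B15DeterminingSets B12RegularSpaces111 B14RegularSpaces234 B14Radii T4AxialGaugeSmallField

/-! ## §1  The (1.7)∕(1.9) plaquette and bond sets with scale 0 read on a top domain `Ω₀` -/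

section Sets

variable {P : Params}

/-- **(1.7)'s PLAQUETTE SET AT SCALE `j` FOR THE TOP DOMAIN `Ω₀`** ([15] (2): «p ∈ Ω_j, j = 0, 1, …, k», configurations «on Ω₀»; p.77 convention: the plaquettes with at least one corner in
the set): at `j = 0` the plaquettes meeting `Ω₀` (def-R's FILE 16 `omegaPlaqs` reads `T_η` there), at `j ≥ 1` the plaquettes meeting `Ω_j` as before.  node00-def-R FILE 22′ spells the same
set `plaqsOf (seqTop Ω₀ Ω j)` (`rfl`). [cite: Balaban1985Variational, (2) p.278; Balaban1985RegularSpaces, (1.7) p.77, p.77 (convention before (1.5))] -/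
def Sect2.omegaPlaqsTop (Ω : ℕ → Set (Site P 0)) (Ω₀ : Set (Site P 0)) (j : ℕ) : Set (Plaq P 0) :=
  B8Eq17ClassAkV1.plaqsOf (if j = 0 then Ω₀ else Ω j)

/-- Scale `0`: the plaquettes meeting the top domain. [cite: Balaban1985Variational, (2) p.278 (bookkeeping)] -/
theorem Sect2.omegaPlaqsTop_zero (Ω : ℕ → Set (Site P 0)) (Ω₀ : Set (Site P 0)) : Sect2.omegaPlaqsTop Ω Ω₀ 0 = B8Eq17ClassAkV1.plaqsOf Ω₀ := by
  simp [Sect2.omegaPlaqsTop]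

/-- Scales `j ≥ 1`: def-R's FILE 16 plaquette set, unchanged. [cite: Balaban1985RegularSpaces, (1.7) p.77 (bookkeeping)] -/
theorem Sect2.omegaPlaqsTop_of_ne_zero (Ω : ℕ → Set (Site P 0)) (Ω₀ : Set (Site P 0)) {j : ℕ} (hj : j ≠ 0) :
    Sect2.omegaPlaqsTop Ω Ω₀ j = omegaPlaqs Ω j := by
  simp [Sect2.omegaPlaqsTop, omegaPlaqs_of_ne_zero Ω hj, hj]

/-- With `Ω₀ = T_η` the top-domain plaquette sets ARE FILE 16's (`plaqsOf univ = univ`). [cite: Balaban1985RegularSpaces, (1.3) p.77, p.77 (convention before (1.5))] -/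
theorem Sect2.omegaPlaqsTop_univ (Ω : ℕ → Set (Site P 0)) (j : ℕ) : Sect2.omegaPlaqsTop Ω Set.univ j = omegaPlaqs Ω j := by
  by_cases hj : j = 0
  · subst hj; simp [Sect2.omegaPlaqsTop, omegaPlaqs, B8Eq17ClassAkV1.plaqsOf_univ]
  · exact Sect2.omegaPlaqsTop_of_ne_zero Ω _ hj

/-- The top-domain plaquette sets lie inside FILE 16's (scale `0`: `plaqsOf Ω₀ ⊆ univ`). [cite: Balaban1985RegularSpaces, (1.7) p.77 (bookkeeping)] -/
theorem Sect2.omegaPlaqsTop_subset (Ω : ℕ → Set (Site P 0)) (Ω₀ : Set (Site P 0)) (j : ℕ) : Sect2.omegaPlaqsTop Ω Ω₀ j ⊆ omegaPlaqs Ω j := by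
  by_cases hj : j = 0
  · subst hj; simp [omegaPlaqs]
  · rw [Sect2.omegaPlaqsTop_of_ne_zero Ω Ω₀ hj]

/-- The top-domain plaquette sets are MONOTONE in `Ω₀`. [cite: Balaban1985RegularSpaces, (1.7) p.77 (bookkeeping)] -/
theorem Sect2.omegaPlaqsTop_mono (Ω : ℕ → Set (Site P 0)) {Ω₀ Ω₀' : Set (Site P 0)} (h : Ω₀' ⊆ Ω₀) (j : ℕ) :
    Sect2.omegaPlaqsTop Ω Ω₀' j ⊆ Sect2.omegaPlaqsTop Ω Ω₀ j := by
  by_cases hj : j = 0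
  · subst hj
    simp only [Sect2.omegaPlaqsTop_zero]
    exact B8Eq17ClassAkV1.plaqsOf_mono h
  · unfold Sect2.omegaPlaqsTop; simp [hj]

/-- **(1.9)'s BOND SET AT SCALE `j` FOR THE TOP DOMAIN `Ω₀`** ([15] (2): «b ∈ Ω_j, j = 0, 1, …, k», configurations «on Ω₀»; p.77 convention: the bonds with at least one endpoint in the
set): at `j = 0` the bonds meeting `Ω₀` (FILE 9's `Sect2.omegaBonds` reads `T_η` there), at `j ≥ 1` the bonds meeting `Ω_j` as before.  node00-def-R FILE 22′ spells the same set
`bondsOf (seqTop Ω₀ Ω j)` (`rfl`). [cite: Balaban1985Variational, (2) p.278; Balaban1985RegularSpaces, (1.9) p.77] -/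
def Sect2.omegaBondsTop (Ω : ℕ → Set (Site P 0)) (Ω₀ : Set (Site P 0)) (j : ℕ) : Set (PBond P 0) :=
  bondsOf (if j = 0 then Ω₀ else Ω j)

/-- Scale `0`: the bonds meeting the top domain. [cite: Balaban1985Variational, (2) p.278 (bookkeeping)] -/
theorem Sect2.omegaBondsTop_zero (Ω : ℕ → Set (Site P 0)) (Ω₀ : Set (Site P 0)) : Sect2.omegaBondsTop Ω Ω₀ 0 = bondsOf Ω₀ := by
  simp [Sect2.omegaBondsTop]

/-- Scales `j ≥ 1`: FILE 9's bond set, unchanged. [cite: Balaban1985RegularSpaces, (1.9) p.77 (bookkeeping)] -/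
theorem Sect2.omegaBondsTop_of_ne_zero (Ω : ℕ → Set (Site P 0)) (Ω₀ : Set (Site P 0)) {j : ℕ} (hj : j ≠ 0) :
    Sect2.omegaBondsTop Ω Ω₀ j = Sect2.omegaBonds Ω j := by
  simp [Sect2.omegaBondsTop, Sect2.omegaBonds, hj]

/-- With `Ω₀ = T_η` the top-domain bond sets ARE FILE 9's (`bondsOf univ = univ`). [cite: Balaban1985RegularSpaces, (1.3) p.77, p.77 (convention before (1.5))] -/
theorem Sect2.omegaBondsTop_univ (Ω : ℕ → Set (Site P 0)) (j : ℕ) : Sect2.omegaBondsTop Ω Set.univ j = Sect2.omegaBonds Ω j := by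
  by_cases hj : j = 0
  · subst hj; simp [Sect2.omegaBondsTop, Sect2.omegaBonds, B8Eq17ClassAkV1.bondsOf_univ]
  · exact Sect2.omegaBondsTop_of_ne_zero Ω _ hj

/-- The top-domain bond sets lie inside FILE 9's (scale `0`: `bondsOf Ω₀ ⊆ univ`). [cite: Balaban1985RegularSpaces, (1.9) p.77 (bookkeeping)] -/
theorem Sect2.omegaBondsTop_subset (Ω : ℕ → Set (Site P 0)) (Ω₀ : Set (Site P 0)) (j : ℕ) : Sect2.omegaBondsTop Ω Ω₀ j ⊆ Sect2.omegaBonds Ω j := by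
  by_cases hj : j = 0
  · subst hj; simp [Sect2.omegaBonds]
  · rw [Sect2.omegaBondsTop_of_ne_zero Ω Ω₀ hj]

/-- The top-domain bond sets are MONOTONE in `Ω₀`. [cite: Balaban1985RegularSpaces, (1.9) p.77 (bookkeeping)] -/
theorem Sect2.omegaBondsTop_mono (Ω : ℕ → Set (Site P 0)) {Ω₀ Ω₀' : Set (Site P 0)} (h : Ω₀' ⊆ Ω₀) (j : ℕ) :
    Sect2.omegaBondsTop Ω Ω₀' j ⊆ Sect2.omegaBondsTop Ω Ω₀ j := by
  by_cases hj : j = 0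
  · subst hj
    simp only [Sect2.omegaBondsTop_zero]
    rintro b (hb | hb)
    · exact Or.inl (h hb)
    · exact Or.inr (h hb)
  · unfold Sect2.omegaBondsTop; simp [hj]

end Sets

/-! ## §2  The (1.9)-half of `U_k({Ω_j}, ε)` ON THE TOP DOMAIN `Ω₀` -/

section CoDivTop

variable {P : Params} {N : ℕ} [NeZero N]

/-- **★ THE (1.9)-HALF OF THE REGULAR SPACE `U_k({Ω_j}, ε)` OF CONFIGURATIONS ON `Ω₀`** ([15] (2), second line, «b ∈ Ω_j, j = 0, 1, …, k» with `Ω₀` the top domain of the problem — [III]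
p.255: the support): for every `j ≤ k`, `‖η·(D^{η*}_U ∂U)(b)‖ < ε·η_j³` on `Sect2.omegaBondsTop Ω Ω₀ j`.  FILE 9's `Sect2.CoDivClassOn` is the case `Ω₀ = T_η` (`coDivClassOnTop_univ_iff`);
re-ranging scale `0` to the support is director-ym №160 (F7-b)'s cure of FINDING №7 on the (1.9) member (the pinned far field is NOT asked to be (1.9)-small).
[cite: Balaban1985Variational, (2) p.278; Balaban1985RegularSpaces, (1.1)–(1.2) p.76, (1.9) p.77; Balaban1988Convergent, (2.12) p.256, p.255] -/
def Sect2.CoDivClassOnTop (Ω : ℕ → Set (Site P 0)) (Ω₀ : Set (Site P 0)) (k : ℕ) (ε : ℝ) (U : GaugeField P 0 (SU N)) : Prop :=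
  ∀ j, j ≤ k → Sect2.CoDivSmallOn (Sect2.omegaBondsTop Ω Ω₀ j) (ε * P.eta j ^ 3) U

/-- Weakening the threshold (`0 ≤ η_j³`). [cite: Balaban1985RegularSpaces, (1.9) p.77 (bookkeeping)] -/
theorem Sect2.CoDivClassOnTop.of_le {Ω : ℕ → Set (Site P 0)} {Ω₀ : Set (Site P 0)} {k : ℕ} {ε ε' : ℝ} {U : GaugeField P 0 (SU N)}
    (h : Sect2.CoDivClassOnTop Ω Ω₀ k ε U) (hε : ε ≤ ε') : Sect2.CoDivClassOnTop Ω Ω₀ k ε' U := fun j hj =>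
  (h j hj).of_le (mul_le_mul_of_nonneg_right hε (pow_nonneg (pow_pos (inv_pos.mpr (Nat.cast_pos.mpr P.L_pos)) j).le 3))

/-- ANTITONE in the top domain: (1.9) on a larger `Ω₀` gives (1.9) on a smaller one. [cite: Balaban1985RegularSpaces, (1.9) p.77 (bookkeeping)] -/
theorem Sect2.CoDivClassOnTop.anti {Ω : ℕ → Set (Site P 0)} {Ω₀ Ω₀' : Set (Site P 0)} {k : ℕ} {ε : ℝ} {U : GaugeField P 0 (SU N)}
    (h : Sect2.CoDivClassOnTop Ω Ω₀ k ε U) (hΩ : Ω₀' ⊆ Ω₀) : Sect2.CoDivClassOnTop Ω Ω₀' k ε U := fun j hj =>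
  (h j hj).mono (Sect2.omegaBondsTop_mono Ω hΩ j)

/-- FILE 9's GLOBAL (1.9)-class (`Ω₀ = T_η`) implies the class on any top domain. [cite: Balaban1985RegularSpaces, (1.9) p.77 (bookkeeping)] -/
theorem Sect2.CoDivClassOn.toTop {Ω : ℕ → Set (Site P 0)} (Ω₀ : Set (Site P 0)) {k : ℕ} {ε : ℝ} {U : GaugeField P 0 (SU N)}
    (h : Sect2.CoDivClassOn Ω k ε U) : Sect2.CoDivClassOnTop Ω Ω₀ k ε U := fun j hj =>
  (h j hj).mono (Sect2.omegaBondsTop_subset Ω Ω₀ j)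

/-- At `Ω₀ = T_η` the top-domain class IS FILE 9's class. [cite: Balaban1985RegularSpaces, (1.3),(1.9) p.77] -/
theorem Sect2.coDivClassOnTop_univ_iff (Ω : ℕ → Set (Site P 0)) (k : ℕ) (ε : ℝ) (U : GaugeField P 0 (SU N)) :
    Sect2.CoDivClassOnTop Ω Set.univ k ε U ↔ Sect2.CoDivClassOn Ω k ε U := by
  constructor
  · intro h j hj
    have := h j hj
    rwa [Sect2.omegaBondsTop_univ] at this
  · intro h j hj
    rw [Sect2.omegaBondsTop_univ]
    exact h j hj

end CoDivTop

/-! ## §3  Print's (7) at LEVEL 0 for the top domain `Ω₀`: the `Λ₀`-plaquettes and the data predicate -/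

section DataTop

variable {P : Params} {G : Type*} [GaugeGroup G]

/-- **★ PRINT'S (7) PLAQUETTES AT LEVEL 0 FOR THE TOP DOMAIN `Ω₀`** («p′ ∈ Λ₀», `Λ₀ ⊂ Ω₀∖Ω₁`, with the p.278 boundary rule): FILE 8's CONCORD range `Sect2.printedPlaqs Ω k 0` (touching
`Γ₀ = Ω₁ᶜ`, no bond inside `Ω₁`) cut to the plaquettes MEETING `Ω₀` (p.77 convention — the convention of the class's scale-0 clause `plaqsOf Ω₀`, so that every all-pinned plaquette the
conclusion (8)₀ speaks about, and the whole stencil of its co-divergence member at a pinned bond meeting `Ω₀`, is a (7)₀ plaquette; in print the configurations live on `Ω₀` and rim plaquettes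
sticking out do not exist).  When `dist(Ω₁, Ω₀ᶜ) ≥ 2` (the record's collar is a layer of `M₁`-cubes) these are the printed plaquettes meeting `Ω₀∖Ω₁` plus the pure-data ones meeting `Ω₁`.
`= Sect2.printedPlaqs Ω k 0` at `Ω₀ = univ`.
-- TODO(general form): (7) for an arbitrary admissible `𝔅_k` of [6] Sect. A; here `𝔅_k = genSet Ω k` of a (2.18) index, top domain `Ω₀`.
[cite: Balaban1985Variational, (3),(7) p.278 L20–33; Balaban1985RegularSpaces, (1.5) p.77; Balaban1988Convergent, p.255, (2.10) p.256] -/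
def Sect2.printedPlaqsTop (Ω : ℕ → Set (Site P 0)) (Ω₀ : Set (Site P 0)) (k : ℕ) : Set (Plaq P 0) :=
  Sect2.printedPlaqs Ω k 0 ∩ B8Eq17ClassAkV1.plaqsOf Ω₀

/-- The level-0 top-domain range lies inside FILE 8's CONCORD range. [cite: Balaban1985Variational, (7) p.278 (bookkeeping)] -/
theorem Sect2.printedPlaqsTop_subset (Ω : ℕ → Set (Site P 0)) (Ω₀ : Set (Site P 0)) (k : ℕ) : Sect2.printedPlaqsTop Ω Ω₀ k ⊆ Sect2.printedPlaqs Ω k 0 :=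
  Set.inter_subset_left

/-- At `Ω₀ = T_η` the cut is void. [cite: Balaban1985Variational, (7) p.278 (bookkeeping)] -/
theorem Sect2.printedPlaqsTop_univ (Ω : ℕ → Set (Site P 0)) (k : ℕ) : Sect2.printedPlaqsTop Ω Set.univ k = Sect2.printedPlaqs Ω k 0 := by
  rw [Sect2.printedPlaqsTop, B8Eq17ClassAkV1.plaqsOf_univ, Set.inter_univ]

/-- The level-0 range is MONOTONE in the top domain. [cite: Balaban1985Variational, (7) p.278 (bookkeeping)] -/
theorem Sect2.printedPlaqsTop_mono (Ω : ℕ → Set (Site P 0)) {Ω₀ Ω₀' : Set (Site P 0)} (h : Ω₀' ⊆ Ω₀) (k : ℕ) :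
    Sect2.printedPlaqsTop Ω Ω₀' k ⊆ Sect2.printedPlaqsTop Ω Ω₀ k :=
  Set.inter_subset_inter_right _ (B8Eq17ClassAkV1.plaqsOf_mono h)

/-- **★ PRINT'S DATA HYPOTHESIS (7) FOR THE TOP DOMAIN `Ω₀`** («|(∂V)(p′) − 1| < ε₁ for p′ ∈ 𝔅_k», `𝔅_k ⊂ Ω₀`, thresholds `δ_n`): level 0 — `W 0` on `Sect2.printedPlaqsTop Ω Ω₀ k` (print's
`Λ₀`-plaquettes; the pinned far field beyond `Ω₀` is NOT read — director-ym №160 F7, the cure of FINDING №7 on the support's (7)-guard); level `m+1 ≤ k` — FILE 8's `Sect2.DataSmall7P` clause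
VERBATIM (the (7) field `mixedField` on `printedPlaqs Ω k (m+1)`).  `↔ Sect2.DataSmall7P` at `Ω₀ = univ`; antitone in `Ω₀`.
-- TODO(general form): (7) for an arbitrary admissible `𝔅_k` of [6] Sect. A; here `𝔅_k = genSet Ω k` of a (2.18) index.
[cite: Balaban1985Variational, (3),(7) p.278 L20–33; Balaban1985RegularSpaces, (1.3)–(1.9) p.77; Balaban1988Convergent, p.255, (2.10)–(2.12) p.256] -/
def Sect2.DataSmall7PTop (av : ∀ j, Averaging P j G) (Ω : ℕ → Set (Site P 0)) (Ω₀ : Set (Site P 0)) (k : ℕ) (δ : ℕ → ℝ) (W : MSField P G) : Prop :=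
  PlaqSmallOn (Sect2.printedPlaqsTop Ω Ω₀ k) (δ 0) (W 0) ∧
    ∀ m, m + 1 ≤ k → PlaqSmallOn (Sect2.printedPlaqs Ω k (m + 1)) (δ (m + 1)) (Sect2.mixedField av (genSet Ω k (m + 1)) (W (m + 1)) (W m))

/-- FILE 8's (7) on ALL of `Ω₁ᶜ` implies (7) for any top domain. [cite: Balaban1985Variational, (7) p.278 (bookkeeping)] -/
theorem Sect2.DataSmall7P.toTop {av : ∀ j, Averaging P j G} {Ω : ℕ → Set (Site P 0)} (Ω₀ : Set (Site P 0)) {k : ℕ} {δ : ℕ → ℝ} {W : MSField P G}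
    (h : Sect2.DataSmall7P av Ω k δ W) : Sect2.DataSmall7PTop av Ω Ω₀ k δ W :=
  ⟨fun p hp => h.1 p (Sect2.printedPlaqsTop_subset Ω Ω₀ k hp), h.2⟩

/-- The level-0 clause. [cite: Balaban1985Variational, (7) p.278 (bookkeeping)] -/
theorem Sect2.DataSmall7PTop.zero {av : ∀ j, Averaging P j G} {Ω : ℕ → Set (Site P 0)} {Ω₀ : Set (Site P 0)} {k : ℕ} {δ : ℕ → ℝ} {W : MSField P G}
    (h : Sect2.DataSmall7PTop av Ω Ω₀ k δ W) : PlaqSmallOn (Sect2.printedPlaqsTop Ω Ω₀ k) (δ 0) (W 0) := h.1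

/-- The level-`(m+1)` clause in the `spliceAt` spelling (FILE 8 `Sect2.mixedField_eq_spliceAt`). [cite: Balaban1985Variational, (7) p.278 (bookkeeping)] -/
theorem Sect2.DataSmall7PTop.succ {av : ∀ j, Averaging P j G} {Ω : ℕ → Set (Site P 0)} {Ω₀ : Set (Site P 0)} {k : ℕ} {δ : ℕ → ℝ} {W : MSField P G}
    (h : Sect2.DataSmall7PTop av Ω Ω₀ k δ W) {m : ℕ} (hm : m + 1 ≤ k) :
    PlaqSmallOn (Sect2.printedPlaqs Ω k (m + 1)) (δ (m + 1)) (spliceAt (genSet Ω k (m + 1)) (W (m + 1)) ((av m).avg (W m))) := h.2 m hm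

/-- (7) for the top domain FROM ITS TWO CLAUSES (`spliceAt` spelling). [cite: Balaban1985Variational, (7) p.278 (bookkeeping)] -/
theorem Sect2.DataSmall7PTop.of_spliceAt {av : ∀ j, Averaging P j G} {Ω : ℕ → Set (Site P 0)} {Ω₀ : Set (Site P 0)} {k : ℕ} {δ : ℕ → ℝ} {W : MSField P G}
    (h0 : PlaqSmallOn (Sect2.printedPlaqsTop Ω Ω₀ k) (δ 0) (W 0))
    (hsucc : ∀ m, m + 1 ≤ k → PlaqSmallOn (Sect2.printedPlaqs Ω k (m + 1)) (δ (m + 1)) (spliceAt (genSet Ω k (m + 1)) (W (m + 1)) ((av m).avg (W m)))) :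
    Sect2.DataSmall7PTop av Ω Ω₀ k δ W := ⟨h0, hsucc⟩

/-- Weakening the thresholds. [cite: Balaban1985Variational, (7) p.278 (bookkeeping)] -/
theorem Sect2.DataSmall7PTop.of_le {av : ∀ j, Averaging P j G} {Ω : ℕ → Set (Site P 0)} {Ω₀ : Set (Site P 0)} {k : ℕ} {δ δ' : ℕ → ℝ} {W : MSField P G}
    (h : Sect2.DataSmall7PTop av Ω Ω₀ k δ W) (hδ : ∀ n, n ≤ k → δ n ≤ δ' n) : Sect2.DataSmall7PTop av Ω Ω₀ k δ' W :=
  ⟨fun p hp => (h.1 p hp).trans_le (hδ 0 (Nat.zero_le _)), fun m hm p hp => (h.2 m hm p hp).trans_le (hδ (m + 1) hm)⟩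

/-- ANTITONE in the top domain: (7) read on a larger `Ω₀` gives (7) on a smaller one. [cite: Balaban1985Variational, (7) p.278 (bookkeeping)] -/
theorem Sect2.DataSmall7PTop.anti {av : ∀ j, Averaging P j G} {Ω : ℕ → Set (Site P 0)} {Ω₀ Ω₀' : Set (Site P 0)} {k : ℕ} {δ : ℕ → ℝ} {W : MSField P G}
    (h : Sect2.DataSmall7PTop av Ω Ω₀ k δ W) (hΩ : Ω₀' ⊆ Ω₀) : Sect2.DataSmall7PTop av Ω Ω₀' k δ W :=
  ⟨fun p hp => h.1 p (Sect2.printedPlaqsTop_mono Ω hΩ k hp), h.2⟩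

/-- At `Ω₀ = T_η` the top-domain (7) IS FILE 8's `Sect2.DataSmall7P`. [cite: Balaban1985Variational, (7) p.278; Balaban1985RegularSpaces, (1.3) p.77] -/
theorem Sect2.dataSmall7PTop_univ_iff (av : ∀ j, Averaging P j G) (Ω : ℕ → Set (Site P 0)) (k : ℕ) (δ : ℕ → ℝ) (W : MSField P G) :
    Sect2.DataSmall7PTop av Ω Set.univ k δ W ↔ Sect2.DataSmall7P av Ω k δ W := by
  unfold Sect2.DataSmall7PTop Sect2.DataSmall7P
  rw [Sect2.printedPlaqsTop_univ]

end DataTop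

/-! ## §4  FILE 10 §2's analysis WITHOUT the scale-0 class bound (the row's body reads the class bounds at the scales `1 ≤ n ≤ k` only) -/

section RecordUPos

variable {F : T4Family} {N : ℕ} [NeZero N]

/-- **★★ THE ROW'S BODY FOR AN ARBITRARY BACKGROUND `U` FROM PER-SCALE CLASS BOUNDS AT THE SCALES `1 ≤ n ≤ k` ONLY** + numerics + (C1)(C2) + no wrapping + the displayed derivative
members `h3I`∕`h3MS`: FILE 10's `bgRowAtDatumU_of_classBounds` with the hypothesis `hclass` restricted to `1 ≤ n` (its proof never read `n = 0`), so that a conclusion (8) whose scale-0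
member lives on a top domain `Ω₀ ≠ T_η` (F7) feeds the row unchanged.  Proof = FILE 10's, verbatim. [cite: Balaban1988Convergent, (2.27)–(2.28) p.259, (2.34)–(2.41) p.261; Balaban1987RG1, (1.11)–(1.16) p.262] -/
theorem bgRowAtDatumU_of_classBoundsPos (S : Sect2.Setting (MatA N) (SU N)) (hι : S.ι = ιSU N) (h𝓜 : S.𝓜 = B12RegularSpaces111SpecialUnitary.suModel N) (hS : S.Laws)
    (hpos : S.Pos) (ν : Stage7Numerics) {M : ℕ} (hM : 0 < M) (K k : ℕ) {b : ℕ → ℝ} (hb0 : ∀ n, 1 ≤ n → n ≤ k → 0 ≤ b n)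
    (s : SeqOfRecord F ν M S.flow.g K k) (U : GaugeField (F.P K) 0 (SU N))
    (hclass : ∀ n, 1 ≤ n → n ≤ k → PlaqSmallOn (omegaPlaqs s.Ω n) (b n * (F.P K).eta n ^ 2) (U))
    (hα : ∀ n, 1 ≤ n → n ≤ k → 0 < S.lf.alpha0 (S.flow.g n) ∧ 0 < S.lf.alpha1 (S.flow.g n))
    (hbα : ∀ n, 1 ≤ n → n ≤ k → b n ≤ (1 - S.βc) * S.lf.alpha0 (S.flow.g n))
    (hsN : ∀ n, 1 ≤ n → n ≤ k + 1 → ((B14.Eq213MaximalDomains.side (F.P K).L M n : ℕ) : ℤ) < (F.P K).sitesPerDir 0)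
    (hcB : 2 * (((F.P K).d - 1 : ℕ) : ℝ) * ((F.P K).L * M) < S.cB) (hBCM : 2 * (((F.P K).d - 1 : ℕ) : ℝ) * M < S.B * S.C * S.Mr)
    (hsmallI : ∀ j, 1 ≤ j → j ≤ k → (((F.P K).d - 1 : ℕ) : ℝ) * ((F.P K).L * M) * (F.P K).eta j * b j ≤ 1 / 2)
    (hsmallMS : ∀ n, 1 ≤ n → n ≤ k → (((F.P K).d - 1 : ℕ) : ℝ) * M * (F.P K).eta n * b n ≤ 1 / 2)
    (hC1 : ∀ j, 1 ≤ j → j ≤ k → ∃ t : ℕ, 0 < t ∧ RkOfRecord (F.P K).L ν.r (S.flow.g j) = (F.P K).L * t)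
    (hC2 : ∀ j, 1 ≤ j → j ≤ k → dCubeSide (F.P K).L M (RkOfRecord (F.P K).L ν.r (S.flow.g j)) j ∣ (F.P K).sitesPerDir 0)
    (h3I : ∀ j, 1 ≤ j → j ≤ k → ∀ X : (Sect2.domSys (F.P K) M j).Dom, Sect2.domSites (F.P K) M j X ⊆ s.Λ j →
      ∀ a ∈ cubeIndices (F.P K) (B14.Eq213MaximalDomains.side (F.P K).L M (j + 1)),
        (cubeEnl (F.P K) (B14.Eq213MaximalDomains.side (F.P K).L M (j + 1)) a 0 ∩ Sect2.domSites (F.P K) M j X).Nonempty →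
        ∀ q ∈ (Sect2.regionOfSet (F.P K) (cubeEnl (F.P K) (B14.Eq213MaximalDomains.side (F.P K).L M (j + 1)) a 0 ∩ Sect2.domSites (F.P K) M j X)).dpairs,
          ‖grad ((F.P K).eta j) q.2.1 (fun y => axialPotential (U)
            (boxLo (B14.Eq213MaximalDomains.side (F.P K).L M (j + 1)) a) (boxHi (B14.Eq213MaximalDomains.side (F.P K).L M (j + 1)) a) ((F.P K).eta j)
            ⟨y, q.2.2⟩) q.1‖ < S.cB * S.lf.alpha0 (S.flow.g j))
    (h3MS : ∀ j, 1 ≤ j → j ≤ k → ∀ X : (Sect2.domSys (F.P K) M j).Dom, ∀ n, 1 ≤ n → n ≤ j →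
      ∀ a ∈ cubeIndices (F.P K) (B14.Eq213MaximalDomains.side (F.P K).L M n),
        (cubeEnl (F.P K) (B14.Eq213MaximalDomains.side (F.P K).L M n) a 0 ∩ Sect2.domSites (F.P K) M j X).Nonempty →
        cubeEnl (F.P K) (B14.Eq213MaximalDomains.side (F.P K).L M n) a 0 ⊆ s.Ω n →
        ∀ q ∈ (Sect2.regionOfSet (F.P K) (cubeEnl (F.P K) (B14.Eq213MaximalDomains.side (F.P K).L M n) a 0 ∩ Sect2.domSites (F.P K) M j X)).dpairs,
          (((F.P K).L : ℝ) ^ n * (F.P K).eta j) ^ 2 * ‖grad ((F.P K).eta j) q.2.1 (fun y => axialPotential (U)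
            (boxLo (B14.Eq213MaximalDomains.side (F.P K).L M n) a) (boxHi (B14.Eq213MaximalDomains.side (F.P K).L M n) a) ((F.P K).eta j) ⟨y, q.2.2⟩) q.1‖ <
            rad238 S.B S.C S.Mr (S.lf.alpha0 (S.flow.g n))) :
    ∀ j, 1 ≤ j → j ≤ k → ∀ X : (Sect2.domSys (F.P K) M j).Dom,
      (Sect2.domSites (F.P K) M j X ⊆ s.Λ j →
        Sect2.ofBackgroundC S.ι (U) ∈
          Sect2.spaceI S (Sect2.Residual.unit (F.P K) (MatA N)) M j (Sect2.domSites (F.P K) M j X) (S.lf.alpha0 (S.flow.g j)) (S.lf.alpha1 (S.flow.g j))) ∧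
      (Sect2.admB (F.P K) ν M S.flow.g s.Ω s.Λ j (Sect2.domSites (F.P K) M j X) = true →
        Sect2.ofBackgroundC S.ι (U) ∈
          Sect2.spaceMS S (Sect2.Residual.unit (F.P K) (MatA N)) M j (Sect2.domSites (F.P K) M j X) s.Ω) := by
  intro j h1 hjk X
  have hd : (0 : ℝ) ≤ (((F.P K).d - 1 : ℕ) : ℝ) := Nat.cast_nonneg _
  have hηj : 0 < (F.P K).eta j := pow_pos (inv_pos.mpr (Nat.cast_pos.mpr (F.P K).L_pos)) j
  have hbα' : ∀ n, 1 ≤ n → n ≤ k → b n ≤ S.lf.alpha0 (S.flow.g n) := by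
    intro n hn1 hnk
    refine (hbα n hn1 hnk).trans ?_
    have h0 := (hα n hn1 hnk).1.le
    nlinarith [hpos.βc_nonneg, h0]
  refine ⟨fun hX => ?_, fun _ => ?_⟩
  · -- the `U^c_j` conjunct: class bound at scale `j`, (1.12)(a)(b) by the axial gauge on the cubes of `X`, (c) displayed
    have hcubeΩ := hcubeΩ_of_compatible (F := F) ν hM S.flow.g K k s hC1 hC2 j h1 hjk X hX
    have hloc : ∀ C ∈ Sect2.cubesI M j (Sect2.domSites (F.P K) M j X), ∃ u : Site (F.P K) 0 → (MatA N)ˣ, (∀ x, u x ∈ S.𝓜.G) ∧ ∃ A : PBond (F.P K) 0 → MatA N,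
          (∀ bd ∈ C.bonds, gaugeU u (fun b' => S.ι (U b')) bd = expI ((F.P K).eta j) (A bd)) ∧
          (∀ bd ∈ C.bonds, ‖A bd‖ < S.cB * S.lf.alpha0 (S.flow.g j)) ∧
          ∀ q ∈ C.dpairs, ‖grad ((F.P K).eta j) q.2.1 (fun y => A ⟨y, q.2.2⟩) q.1‖ < S.cB * S.lf.alpha0 (S.flow.g j) := by
      have hclassj : PlaqSmallOn (B8Eq17ClassAkV1.plaqsOf (s.Ω j)) (b j * (F.P K).eta j ^ 2) (U) := by
        have h := hclass j h1 hjk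
        rwa [omegaPlaqs_of_ne_zero _ (Nat.one_le_iff_ne_zero.mp h1)] at h
      have hside := side_pred_mul_eta_le (P := F.P K) M j
      have hα0 : 0 < S.lf.alpha0 (S.flow.g j) := (hα j h1 hjk).1
      have hs0 : (0 : ℝ) ≤ ((B14.Eq213MaximalDomains.side (F.P K).L M (j + 1) - 1 : ℕ) : ℝ) := Nat.cast_nonneg _
      have hbj0 := hb0 j h1 hjk
      have hsmall : (((F.P K).d - 1 : ℕ) : ℝ) * ((B14.Eq213MaximalDomains.side (F.P K).L M (j + 1) - 1 : ℕ) : ℝ) * (b j * (F.P K).eta j ^ 2) ≤ 1 / 2 := by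
        calc (((F.P K).d - 1 : ℕ) : ℝ) * ((B14.Eq213MaximalDomains.side (F.P K).L M (j + 1) - 1 : ℕ) : ℝ) * (b j * (F.P K).eta j ^ 2)
            = (((F.P K).d - 1 : ℕ) : ℝ) * ((((B14.Eq213MaximalDomains.side (F.P K).L M (j + 1) - 1 : ℕ) : ℝ)) * (F.P K).eta j) * (F.P K).eta j * b j := by ring
          _ ≤ (((F.P K).d - 1 : ℕ) : ℝ) * ((F.P K).L * M) * (F.P K).eta j * b j := by gcongr
          _ ≤ 1 / 2 := hsmallI j h1 hjk
      have hcB' : 2 * ((((F.P K).d - 1 : ℕ) : ℝ) * ((B14.Eq213MaximalDomains.side (F.P K).L M (j + 1) - 1 : ℕ) : ℝ) * (b j * (F.P K).eta j ^ 2)) / (F.P K).eta j <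
          S.cB * S.lf.alpha0 (S.flow.g j) := by
        rw [div_lt_iff₀ hηj]
        have hbα := hbα' j h1 hjk
        calc 2 * ((((F.P K).d - 1 : ℕ) : ℝ) * ((B14.Eq213MaximalDomains.side (F.P K).L M (j + 1) - 1 : ℕ) : ℝ) * (b j * (F.P K).eta j ^ 2))
            = (2 * (((F.P K).d - 1 : ℕ) : ℝ) * ((((B14.Eq213MaximalDomains.side (F.P K).L M (j + 1) - 1 : ℕ) : ℝ)) * (F.P K).eta j) * b j) * (F.P K).eta j := by ring
          _ ≤ (2 * (((F.P K).d - 1 : ℕ) : ℝ) * ((F.P K).L * M) * S.lf.alpha0 (S.flow.g j)) * (F.P K).eta j := by gcongr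
          _ < S.cB * S.lf.alpha0 (S.flow.g j) * (F.P K).eta j := by
            have := mul_lt_mul_of_pos_right hcB hα0
            nlinarith
      simp only [hι, h𝓜]
      exact localGauge_cubesI_of_classBound (hsN (j + 1) (by omega) (by omega)) hcubeΩ hbj0 hclassj hsmall hcB' (h3I j h1 hjk X hX)
    exact ofBackgroundC_mem_spaceI_of_classBoundU S hι hS ν M S.flow.g K k s U h1 hjk (hα j h1 hjk).1 (hα j h1 hjk).2 X hX
      (hbα' j h1 hjk) (hclass j h1 hjk) hloc
  · -- the `Ũ^c_j` conjunct: class bounds at the scales `1 ≤ n ≤ j`, (2.34) plaquettes, (2.38)(a)(b) by the axial gauge on the layer cubes, (c) displayed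
    have h238 : CondII238 S.𝓜 (Sect2.frameMS (Sect2.Residual.unit (F.P K) (MatA N)) M j (Sect2.domSites (F.P K) M j X) s.Ω)
          (MSConsts.ofParams (F.P K) S.βc S.B S.C S.Mr j) (fun n => S.lf.alpha0 (S.flow.g n)) (fun b' => S.ι (U b')) := by
      have hclassn : ∀ n, 1 ≤ n → n ≤ j →
          PlaqSmallOn (B8Eq17ClassAkV1.plaqsOf (s.Ω n)) (b n * (F.P K).eta n ^ 2) (U) := by
        intro n hn1 hnj
        have h := hclass n hn1 (hnj.trans hjk)
        rwa [omegaPlaqs_of_ne_zero _ (Nat.one_le_iff_ne_zero.mp hn1)] at h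
      have key : ∀ n, 1 ≤ n → n ≤ j →
          (((F.P K).d - 1 : ℕ) : ℝ) * ((B14.Eq213MaximalDomains.side (F.P K).L M n - 1 : ℕ) : ℝ) * (b n * (F.P K).eta n ^ 2) ≤
            (((F.P K).d - 1 : ℕ) : ℝ) * M * (F.P K).eta n * b n := by
        intro n hn1 hnj
        have hside := side_pred_mul_eta_le' (P := F.P K) M n
        have hηn : 0 ≤ (F.P K).eta n := (pow_pos (inv_pos.mpr (Nat.cast_pos.mpr (F.P K).L_pos)) n).le
        have hbn0 := hb0 n hn1 (hnj.trans hjk)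
        calc (((F.P K).d - 1 : ℕ) : ℝ) * ((B14.Eq213MaximalDomains.side (F.P K).L M n - 1 : ℕ) : ℝ) * (b n * (F.P K).eta n ^ 2)
            = (((F.P K).d - 1 : ℕ) : ℝ) * (((B14.Eq213MaximalDomains.side (F.P K).L M n - 1 : ℕ) : ℝ) * (F.P K).eta n) * (F.P K).eta n * b n := by ring
          _ ≤ (((F.P K).d - 1 : ℕ) : ℝ) * M * (F.P K).eta n * b n := by gcongr
      simp only [hι, h𝓜]
      refine condII238_cubesMS_of_classBounds (fun n hn1 hnj => hsN n hn1 (by omega)) (fun n hn1 hnj => hb0 n hn1 (hnj.trans hjk)) hclassn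
        (fun n hn1 hnj => (key n hn1 hnj).trans (hsmallMS n hn1 (hnj.trans hjk))) (fun n hn1 hnj => ?_)
        (fun n hn1 hnj a ha hne hΩ q hq => h3MS j h1 hjk X n hn1 hnj a ha hne hΩ q hq)
      have hα0 := (hα n hn1 (hnj.trans hjk)).1
      have hside := side_pred_mul_eta_le' (P := F.P K) M n
      have hbn0 := hb0 n hn1 (hnj.trans hjk)
      have hbα := hbα' n hn1 (hnj.trans hjk)
      have hLη := L_pow_mul_eta (P := F.P K) n
      rw [mul_div_assoc', div_lt_iff₀ hηj]
      unfold rad238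
      calc ((F.P K).L : ℝ) ^ n * (F.P K).eta j * (2 * ((((F.P K).d - 1 : ℕ) : ℝ) * ((B14.Eq213MaximalDomains.side (F.P K).L M n - 1 : ℕ) : ℝ) * (b n * (F.P K).eta n ^ 2)))
          = (2 * (((F.P K).d - 1 : ℕ) : ℝ) * (((B14.Eq213MaximalDomains.side (F.P K).L M n - 1 : ℕ) : ℝ) * (F.P K).eta n) *
              (((F.P K).L : ℝ) ^ n * (F.P K).eta n) * b n) * (F.P K).eta j := by ring
        _ ≤ (2 * (((F.P K).d - 1 : ℕ) : ℝ) * M * 1 * S.lf.alpha0 (S.flow.g n)) * (F.P K).eta j := by rw [hLη]; gcongr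
        _ < S.B * S.C * S.Mr * S.lf.alpha0 (S.flow.g n) * (F.P K).eta j := by
            have := mul_lt_mul_of_pos_right hBCM hα0
            nlinarith
    exact ofBackgroundC_mem_spaceMS_of_classBoundU S hι hS hpos ν M K k s U (fun n hn1 hnj => hα n hn1 (hnj.trans hjk)) X
      (fun n hn1 hnj => hbα n hn1 (hnj.trans hjk)) (fun n hn1 hnj => hclass n hn1 (hnj.trans hjk)) h238

/-- **★★ THE ROW'S BODY FOR AN ARBITRARY BACKGROUND `U` FROM THE TWO PER-SCALE CLASS BOUNDS AT THE SCALES `1 ≤ n ≤ k` ONLY** — plaquette `b_n·η_n²` and the covariant C¹ datum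
`b′_n·η_n³` on the plaquettes inside `Ω_n` (FILE 7b's route: `h3I`∕`h3MS` supplied by `h3I_of_plaqC1`∕`h3MS_of_plaqC1`): FILE 10's `bgRowAtDatumU_of_classBoundsC1` with the scale-0
bound dropped. [cite: Balaban1988Convergent, (2.27)–(2.28) p.259, (2.34)–(2.41) p.261; Balaban1987RG1, (1.11)–(1.16) p.262; Balaban1985Variational, Thm 1 (9)–(10) p.279] -/
theorem bgRowAtDatumU_of_classBoundsC1Pos (S : Sect2.Setting (MatA N) (SU N)) (hι : S.ι = ιSU N) (h𝓜 : S.𝓜 = B12RegularSpaces111SpecialUnitary.suModel N) (hS : S.Laws)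
    (hpos : S.Pos) (ν : Stage7Numerics) {M : ℕ} (hM : 0 < M) (K k : ℕ) {b b' : ℕ → ℝ} (hb0 : ∀ n, 1 ≤ n → n ≤ k → 0 ≤ b n) (hb'0 : ∀ n, 1 ≤ n → n ≤ k → 0 ≤ b' n)
    (s : SeqOfRecord F ν M S.flow.g K k) (U : GaugeField (F.P K) 0 (SU N))
    (hclass : ∀ n, 1 ≤ n → n ≤ k → PlaqSmallOn (omegaPlaqs s.Ω n) (b n * (F.P K).eta n ^ 2) (U))
    (hclassC1 : ∀ n, 1 ≤ n → n ≤ k → PlaqC1SmallOn (plaqInside (s.Ω n)) (b' n * (F.P K).eta n ^ 3) (U))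
    (hα : ∀ n, 1 ≤ n → n ≤ k → 0 < S.lf.alpha0 (S.flow.g n) ∧ 0 < S.lf.alpha1 (S.flow.g n))
    (hbα : ∀ n, 1 ≤ n → n ≤ k → b n ≤ (1 - S.βc) * S.lf.alpha0 (S.flow.g n))
    (hsN : ∀ n, 1 ≤ n → n ≤ k + 1 → ((B14.Eq213MaximalDomains.side (F.P K).L M n : ℕ) : ℤ) < (F.P K).sitesPerDir 0)
    (hcB : 2 * (((F.P K).d - 1 : ℕ) : ℝ) * ((F.P K).L * M) < S.cB) (hBCM : 2 * (((F.P K).d - 1 : ℕ) : ℝ) * M < S.B * S.C * S.Mr)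
    (hsmallI : ∀ j, 1 ≤ j → j ≤ k → (((F.P K).d - 1 : ℕ) : ℝ) * ((F.P K).L * M) * (F.P K).eta j * b j ≤ 1 / 2)
    (hsmallMS : ∀ n, 1 ≤ n → n ≤ k → (((F.P K).d - 1 : ℕ) : ℝ) * M * (F.P K).eta n * b n ≤ 1 / 2)
    (hC1 : ∀ j, 1 ≤ j → j ≤ k → ∃ t : ℕ, 0 < t ∧ RkOfRecord (F.P K).L ν.r (S.flow.g j) = (F.P K).L * t)
    (hC2 : ∀ j, 1 ≤ j → j ≤ k → dCubeSide (F.P K).L M (RkOfRecord (F.P K).L ν.r (S.flow.g j)) j ∣ (F.P K).sitesPerDir 0)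
    (hletterI : ∀ j, 1 ≤ j → j ≤ k →
      4 * (b j + (((F.P K).d - 1 : ℕ) : ℝ) * (((F.P K).L : ℝ) * M) * b' j + 4 * ((((F.P K).d - 1 : ℕ) : ℝ) * (((F.P K).L : ℝ) * M)) ^ 2 * b j ^ 2) <
        S.cB * S.lf.alpha0 (S.flow.g j))
    (hletterMS : ∀ n, 1 ≤ n → n ≤ k →
      4 * (b n + (((F.P K).d - 1 : ℕ) : ℝ) * (M : ℝ) * b' n + 4 * ((((F.P K).d - 1 : ℕ) : ℝ) * (M : ℝ)) ^ 2 * b n ^ 2) < rad238 S.B S.C S.Mr (S.lf.alpha0 (S.flow.g n))) :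
    ∀ j, 1 ≤ j → j ≤ k → ∀ X : (Sect2.domSys (F.P K) M j).Dom,
      (Sect2.domSites (F.P K) M j X ⊆ s.Λ j →
        Sect2.ofBackgroundC S.ι (U) ∈
          Sect2.spaceI S (Sect2.Residual.unit (F.P K) (MatA N)) M j (Sect2.domSites (F.P K) M j X) (S.lf.alpha0 (S.flow.g j)) (S.lf.alpha1 (S.flow.g j))) ∧
      (Sect2.admB (F.P K) ν M S.flow.g s.Ω s.Λ j (Sect2.domSites (F.P K) M j X) = true →
        Sect2.ofBackgroundC S.ι (U) ∈
          Sect2.spaceMS S (Sect2.Residual.unit (F.P K) (MatA N)) M j (Sect2.domSites (F.P K) M j X) s.Ω) := by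
  refine bgRowAtDatumU_of_classBoundsPos S hι h𝓜 hS hpos ν hM K k hb0 s U hclass hα hbα hsN hcB hBCM hsmallI hsmallMS hC1 hC2 ?_ ?_
  · intro j h1 hjk X hX
    have hclassj : PlaqSmallOn (B8Eq17ClassAkV1.plaqsOf (s.Ω j)) (b j * (F.P K).eta j ^ 2) (U) := by
      have := hclass j h1 hjk
      rwa [omegaPlaqs_of_ne_zero _ (Nat.one_le_iff_ne_zero.mp h1)] at this
    exact h3I_of_plaqC1 (hsN (j + 1) (by omega) (by omega)) (hcubeΩ_of_compatible ν hM S.flow.g K k s hC1 hC2 j h1 hjk X hX) (hb0 j h1 hjk) (hb'0 j h1 hjk)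
      hclassj (hclassC1 j h1 hjk) (hsmall_side_of_LM M j (hb0 j h1 hjk) (hsmallI j h1 hjk)) (hletterI j h1 hjk)
  · intro j h1 hjk X n hn1 hnj
    refine h3MS_of_plaqC1 (j := j) (Y := Sect2.domSites (F.P K) M j X) (fun n hn1 hnj => hsN n hn1 (by omega)) (fun n hn1 hnj => hb0 n hn1 (by omega))
      (fun n hn1 hnj => hb'0 n hn1 (by omega)) (fun n hn1 hnj => ?_) (fun n hn1 hnj => hclassC1 n hn1 (by omega))
      (fun n hn1 hnj => hsmall_side_of_M M n (hb0 n hn1 (by omega)) (hsmallMS n hn1 (by omega))) (fun n hn1 hnj => hletterMS n hn1 (by omega)) n hn1 hnj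
    have := hclass n hn1 (by omega)
    rwa [omegaPlaqs_of_ne_zero _ (Nat.one_le_iff_ne_zero.mp hn1)] at this

end RecordUPos

end Literature.MathematicalPhysics.QuantumFieldTheory.Balaban1983to89.Node00

end
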